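import Summits.KontsevichZagierPeriods.KontsevichZagierPeriods.Theorems.SoloInformedSegRepMoves
import HarnessLib
import HarnessLib.Audit

/-!
# SoloInformed — integer relations among logarithms give relations among segments

Solo programme `solo-KontsevichZagierPeriods-informed`, session s112 (kernel project
«`SoloInformedKZPUpTo 1` unconditionally from the tree's kernel Baker theorem»), file 5.

* `soloInformed_segRep_greedy`: if `Log P + Σ_{i ∈ s} Log eᵢ = 0` with `P, eᵢ` algebraic,
  `|Im P| ≤ Re P`, `|Im eᵢ| < Re eᵢ`, then `Seg(h,P) + Σ_{i∈s} Seg(h,eᵢ)` is a relation (common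
  algebraic coefficient `h`).  GREEDY multiplication: at each step multiply `P` by an `eᵢ` whose
  imaginary part has the opposite sign, so the running product stays in the sector
  `|Im| ≤ Re` and the addition lemma (with `u = 1`) applies.
* `soloInformed_zsmul_segRep_sum_mem_relations`: for algebraic `c_k ∉ (−∞,0]` and integers
  `n_k` with `Σ n_k Log c_k = 0`, `Σ n_k • Seg(h, c_k)` is a relation — pass to fourth roots
  (sector `|Im| < Re`), invert the generators with negative multiplicity, unfold multiplicities,
  and run the greedy lemma from `P = 1`.

References: A. Baker, *Transcendental Number Theory* (1975), Ch. 2 (only the shape of integer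
relations is used here); M. Kontsevich, D. Zagier, *Periods* (2001), §1.2; this work.
-/

noncomputable section

open scoped BigOperators ComplexConjugate
open MeasureTheory Set Filter
open Literature.ModelTheory.ExponentialFields
open Literature.NumberTheory.Transcendental Literature.NumberTheory.Transcendental.KZ

namespace Summit.KontsevichZagierPeriods.KontsevichZagierPeriods.Theorems

/-! ### Sector bookkeeping -/

/-- A non-zero `P` with `|Im P| ≤ Re P` has `Re P > 0`. -/
theorem soloInformed_re_pos_of_abs_im_le {P : ℂ} (h : |P.im| ≤ P.re) (h0 : P ≠ 0) :
    0 < P.re := by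
  by_contra hle
  push Not at hle
  have hre : P.re = 0 := le_antisymm hle ((abs_nonneg _).trans h)
  have him : P.im = 0 := by
    rw [hre] at h
    exact abs_nonpos_iff.1 h
  exact h0 (Complex.ext (by simpa using hre) (by simpa using him))

/-- A complex number with positive real part has argument `≠ π`. -/
theorem soloInformed_arg_ne_pi_of_re_pos {z : ℂ} (hz : 0 < z.re) : z.arg ≠ Real.pi := by
  intro hπ
  have := Complex.abs_arg_lt_pi_div_two_iff.2 (Or.inl hz)
  rw [hπ, abs_of_pos Real.pi_pos] at this
  linarith [Real.pi_pos]

/-- **Sector invariant of the greedy product.** If `|Im P| ≤ Re P`, `P ≠ 0`, `|Im e| < Re e` and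
`Im P · Im e ≤ 0`, then `Q = P e` again satisfies `|Im Q| ≤ Re Q`, and `Re Q > 0`. -/
theorem soloInformed_mul_sector {P e : ℂ} (hP : |P.im| ≤ P.re) (hP0 : P ≠ 0) (he : |e.im| < e.re)
    (hsgn : P.im * e.im ≤ 0) : |(P * e).im| ≤ (P * e).re ∧ 0 < (P * e).re := by
  have hPre := soloInformed_re_pos_of_abs_im_le hP hP0
  have h1 := abs_le.1 hP
  have h2 := abs_lt.1 he
  have here : 0 < e.re := (abs_nonneg _).trans_lt he
  have hd1 : 0 < e.re - e.im := by linarith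
  have hd2 : 0 < e.re + e.im := by linarith
  rw [Complex.mul_im, Complex.mul_re]
  refine ⟨abs_le.2 ⟨?_, ?_⟩, by nlinarith [mul_pos hPre here]⟩
  · rcases le_total 0 P.im with hPi | hPi
    · nlinarith [mul_nonneg hPre.le hd2.le, mul_nonneg hPi hd1.le]
    · have hs : 0 ≤ P.re + P.im := by linarith
      nlinarith [mul_nonneg hs hd2.le]
  · rcases le_total 0 P.im with hPi | hPi
    · have hs : 0 ≤ P.re - P.im := by linarith
      nlinarith [mul_nonneg hs hd1.le]
    · nlinarith [mul_nonneg hPre.le hd1.le, mul_nonneg (neg_nonneg.2 hPi) hd2.le]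

/-- **Greedy choice.** If `arg P + Σ_{i∈s} arg eᵢ = 0` with `s` non-empty, some `eᵢ` has
imaginary part of sign opposite to (or compatible with) that of `P`: `Im P · Im eᵢ ≤ 0`. -/
theorem soloInformed_exists_opposite_sign {ι : Type*} {s : Finset ι} (hs : s.Nonempty) {P : ℂ}
    {e : ι → ℂ} (hsum : P.arg + ∑ i ∈ s, (e i).arg = 0) :
    ∃ i ∈ s, P.im * (e i).im ≤ 0 := by
  by_contra hcon
  push Not at hcon
  obtain ⟨i₀, hi₀⟩ := hs
  have h0 := hcon i₀ hi₀
  rcases lt_trichotomy P.im 0 with hneg | hzero | hpos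
  · have hargP : P.arg < 0 := Complex.arg_neg_iff.2 hneg
    have hargs : 0 < ∑ i ∈ s, -(e i).arg := by
      refine Finset.sum_pos (fun i hi => ?_) ⟨i₀, hi₀⟩
      have him : (e i).im < 0 := by
        rcases mul_pos_iff.1 (hcon i hi) with ⟨hp, _⟩ | ⟨_, hq⟩
        · exact absurd hp (not_lt.2 hneg.le)
        · exact hq
      have := Complex.arg_neg_iff.2 him
      linarith
    rw [Finset.sum_neg_distrib] at hargs
    linarith
  · rw [hzero, zero_mul] at h0
    exact lt_irrefl _ h0
  · have hargP : 0 ≤ P.arg := Complex.arg_nonneg_iff.2 hpos.le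
    have hargs : 0 < ∑ i ∈ s, (e i).arg := by
      refine Finset.sum_pos (fun i hi => ?_) ⟨i₀, hi₀⟩
      have him : 0 < (e i).im := by
        rcases mul_pos_iff.1 (hcon i hi) with ⟨_, hq⟩ | ⟨hp, _⟩
        · exact hq
        · exact absurd hp (not_lt.2 hpos.le)
      refine lt_of_le_of_ne (Complex.arg_nonneg_iff.2 him.le) (fun h => ?_)
      have := (Complex.arg_eq_zero_iff.1 h.symm).2
      exact absurd this him.ne'
    linarith

/-! ### Greedy multiplication -/

/-- **Greedy lemma.** For algebraic `h`, algebraic `eᵢ` in the sector `|Im eᵢ| < Re eᵢ`, and an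
algebraic `P ≠ 0` with `|Im P| ≤ Re P`: if `Log P + Σ_{i∈s} Log eᵢ = 0` then
`Seg(h, P) + Σ_{i∈s} Seg(h, eᵢ)` is a relation. Induction on `s`, multiplying `P` by a generator
of opposite imaginary sign (addition lemma with `u = 1`); at `s = ∅`, `P = 1`. [this work] -/
theorem soloInformed_segRep_greedy {ι : Type*} {h : ℂ} (hh : IsAlgebraic ℚ h) {e : ι → ℂ}
    (he : ∀ i, IsAlgebraic ℚ (e i)) (hsec : ∀ i, |(e i).im| < (e i).re) (s : Finset ι) :
    ∀ P : ℂ, IsAlgebraic ℚ P → |P.im| ≤ P.re → P ≠ 0 →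
      Complex.log P + ∑ i ∈ s, Complex.log (e i) = 0 →
      of (soloInformedSegRep h P) + ∑ i ∈ s, of (soloInformedSegRep h (e i)) ∈ relations := by
  classical
  refine Finset.strongInductionOn s (fun s ih => ?_)
  intro P hP hPs hP0 hsum
  rcases s.eq_empty_or_nonempty with hs | hs
  · subst hs
    simp only [Finset.sum_empty, add_zero] at hsum ⊢
    have : P = 1 := by rw [← Complex.exp_log hP0, hsum, Complex.exp_zero]
    rw [this]
    exact soloInformed_segRep_one_mem_relations h
  · have hPre := soloInformed_re_pos_of_abs_im_le hPs hP0
    have hargsum : P.arg + ∑ i ∈ s, (e i).arg = 0 := by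
      have := congrArg Complex.im hsum
      simpa only [Complex.add_im, Complex.im_sum, Complex.log_im, Complex.zero_im] using this
    obtain ⟨i, hi, hsgn⟩ := soloInformed_exists_opposite_sign hs hargsum
    obtain ⟨hQs, hQre⟩ := soloInformed_mul_sector hPs hP0 (hsec i) hsgn
    have hQ0 : P * e i ≠ 0 := fun h0 => by
      rw [h0, Complex.zero_re] at hQre
      exact lt_irrefl _ hQre
    have he0 : e i ≠ 0 := fun h0 => hQ0 (by rw [h0, mul_zero])
    have here : 0 < (e i).re := (abs_nonneg _).trans_lt (hsec i)
    have hlog : Complex.log (P * e i) = Complex.log P + Complex.log (e i) := by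
      rw [Complex.log_mul_eq_add_log_iff hP0 he0]
      have h1 := abs_le.1 (Complex.abs_arg_le_pi_div_two_iff.2 hPre.le)
      have h2 := abs_lt.1 (Complex.abs_arg_lt_pi_div_two_iff.2 (Or.inl here))
      constructor <;> linarith [Real.pi_pos]
    have hsum' : Complex.log (P * e i) + ∑ j ∈ s.erase i, Complex.log (e j) = 0 := by
      rw [hlog, add_assoc, Finset.add_sum_erase s (fun j => Complex.log (e j)) hi]
      exact hsum
    have hIH := ih (s.erase i) (Finset.erase_ssubset hi) (P * e i) (hP.mul (he i)) hQs hQ0 hsum'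
    have hadd := soloInformed_segRep_add_add_sub_mul_mem_relations (u := 1) hh hP (he i)
      (by simp) (by simpa using hPre) (by simpa using here) (by simpa using hQre)
    have := relations.add_mem hIH hadd
    convert this using 1
    rw [← Finset.add_sum_erase s (fun j => of (soloInformedSegRep h (e j))) hi]
    abel

/-! ### Integer relations -/

/-- The inverse of a point of the sector `|Im| < Re` lies in the sector. -/
theorem soloInformed_inv_sector {r : ℂ} (h : |r.im| < r.re) : |r⁻¹.im| < r⁻¹.re := by
  have hre : 0 < r.re := (abs_nonneg _).trans_lt h
  have h0 : r ≠ 0 := fun h0 => by rw [h0, Complex.zero_re] at hre; exact lt_irrefl _ hre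
  have hN : 0 < Complex.normSq r := Complex.normSq_pos.2 h0
  rw [Complex.inv_im, Complex.inv_re, neg_div, abs_neg, abs_div, abs_of_pos hN]
  exact div_lt_div_of_pos_right h hN

/-- **Integer null relations.** For algebraic `h`, algebraic `c_k ∉ (−∞, 0]` and integers `n_k`
with `Σ_k n_k Log c_k = 0`, the combination `Σ_k n_k • Seg(h, c_k)` is a relation. [this work] -/
theorem soloInformed_zsmul_segRep_sum_mem_relations {κ : Type*} [Fintype κ] {h : ℂ}
    (hh : IsAlgebraic ℚ h) {c : κ → ℂ} (hc : ∀ k, IsAlgebraic ℚ (c k))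
    (hc' : ∀ k, c k ∈ Complex.slitPlane) (n : κ → ℤ)
    (hsum : ∑ k, (n k : ℂ) * Complex.log (c k) = 0) :
    ∑ k, n k • of (soloInformedSegRep h (c k)) ∈ relations := by
  classical
  -- fourth roots `r k`, in the sector `|Im| < Re`
  set r : κ → ℂ := fun k => soloInformedSqrt (soloInformedSqrt (c k)) with hr
  have hr4 := fun k => soloInformed_segRep_sub_fourthRoot_mem_relations hh (hc k) (hc' k)
  have h4 : IsAlgebraic ℚ (4 * h) :=
    (by simpa using isAlgebraic_nat (R := ℚ) (A := ℂ) 4 : IsAlgebraic ℚ (4 : ℂ)).mul hh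
  have hrre : ∀ k, 0 < (r k).re := fun k => (abs_nonneg _).trans_lt (hr4 k).2.1
  -- signed generators `f k = r k` or `(r k)⁻¹`
  set f : κ → ℂ := fun k => if 0 ≤ n k then r k else (r k)⁻¹ with hf
  have hfalg : ∀ k, IsAlgebraic ℚ (f k) := by
    intro k
    by_cases hk : 0 ≤ n k
    · simp only [hf, if_pos hk]; exact (hr4 k).1
    · simp only [hf, if_neg hk]; exact (hr4 k).1.inv
  have hfsec : ∀ k, |(f k).im| < (f k).re := by
    intro k
    by_cases hk : 0 ≤ n k
    · simp only [hf, if_pos hk]; exact (hr4 k).2.1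
    · simp only [hf, if_neg hk]; exact soloInformed_inv_sector (hr4 k).2.1
  have hflog : ∀ k, ((n k).natAbs : ℂ) * Complex.log (f k) = (n k : ℂ) * Complex.log (r k) := by
    intro k
    by_cases hk : 0 ≤ n k
    · simp only [hf, if_pos hk]
      obtain ⟨m, hm⟩ := Int.eq_ofNat_of_zero_le hk
      rw [hm, Int.natAbs_natCast, Int.cast_natCast]
    · simp only [hf, if_neg hk]
      obtain ⟨m, hm⟩ := Int.exists_eq_neg_ofNat (not_le.1 hk).le
      rw [Complex.log_inv _ (soloInformed_arg_ne_pi_of_re_pos (hrre k)), hm, Int.natAbs_neg,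
        Int.natAbs_natCast, Int.cast_neg, Int.cast_natCast]
      ring
  -- unfold the multiplicities: index type `Σ k, Fin |n k|`
  have hrel : Complex.log 1 +
      ∑ x ∈ (Finset.univ : Finset (Σ k : κ, Fin (n k).natAbs)), Complex.log (f x.1) = 0 := by
    rw [Complex.log_one, zero_add]
    have : ∑ x : (Σ k : κ, Fin (n k).natAbs), Complex.log (f x.1) =
        ∑ k, ((n k).natAbs : ℂ) * Complex.log (f k) := by
      rw [Fintype.sum_sigma]
      simp only [Finset.sum_const, Finset.card_univ, Fintype.card_fin, nsmul_eq_mul]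
    rw [this]
    simp_rw [hflog]
    have h4th : ∀ k, Complex.log (r k) = Complex.log (c k) / 4 := fun k => (hr4 k).2.2.1
    simp_rw [h4th]
    rw [show ∑ k, (n k : ℂ) * (Complex.log (c k) / 4) = (∑ k, (n k : ℂ) * Complex.log (c k)) / 4
      by rw [Finset.sum_div]; exact Finset.sum_congr rfl fun _ _ => by ring, hsum, zero_div]
  have hG := soloInformed_segRep_greedy h4 (e := fun x : (Σ k : κ, Fin (n k).natAbs) => f x.1)
    (fun x => hfalg x.1) (fun x => hfsec x.1) Finset.univ 1 isAlgebraic_one (by simp) one_ne_zero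
    hrel
  have hS : ∑ k, (n k).natAbs • of (soloInformedSegRep (4 * h) (f k)) ∈ relations := by
    have := relations.sub_mem hG (soloInformed_segRep_one_mem_relations (4 * h))
    rw [add_sub_cancel_left, Fintype.sum_sigma] at this
    simpa only [Finset.sum_const, Finset.card_univ, Fintype.card_fin] using this
  -- compare `n k • Seg(h, c k)` with `|n k| • Seg(4h, f k)`
  have hk : ∀ k, n k • of (soloInformedSegRep h (c k)) -
      (n k).natAbs • of (soloInformedSegRep (4 * h) (f k)) ∈ relations := by
    intro k
    have h1 : n k • of (soloInformedSegRep h (c k)) -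
        n k • of (soloInformedSegRep (4 * h) (r k)) ∈ relations := by
      rw [← zsmul_sub]
      exact relations.zsmul_mem (hr4 k).2.2.2 _
    by_cases hnk : 0 ≤ n k
    · simp only [hf, if_pos hnk]
      convert h1 using 2
      rw [← natCast_zsmul, Int.natAbs_of_nonneg hnk]
    · simp only [hf, if_neg hnk]
      have hinv : of (soloInformedSegRep (4 * h) (r k)⁻¹) + of (soloInformedSegRep (4 * h) (r k)) ∈
          relations := soloInformed_segRep_inv_add_mem_relations h4 (hr4 k).1 (hrre k)
      have h2 := relations.nsmul_mem hinv (n k).natAbs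
      have h3 := relations.sub_mem h1 h2
      convert h3 using 1
      rw [nsmul_add, ← natCast_zsmul, ← natCast_zsmul,
        Int.ofNat_natAbs_of_nonpos (not_le.1 hnk).le, neg_zsmul, neg_zsmul]
      abel
  have := relations.add_mem (sum_mem fun k (_ : k ∈ Finset.univ) => hk k) hS
  rw [← Finset.sum_add_distrib] at this
  simpa only [sub_add_cancel] using this

end Summit.KontsevichZagierPeriods.KontsevichZagierPeriods.Theorems
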